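import Summits.BirchSwinnertonDyer.BirchSwinnertonDyer.Theorems.EisensteinPrimesGrSelmerQuotientCorankLe
import Summits.BirchSwinnertonDyer.BirchSwinnertonDyer.Theorems.EisensteinPrimesXAcImprimitiveNoPTorsionOfPoitouTateAt
import Summits.BirchSwinnertonDyer.BirchSwinnertonDyer.Theorems.EisensteinPrimesStrictEqUnramifiedDualTransfer
import HarnessLib

/-!
# Crux 4 `BSDpOnCellC`: the prop411 DROP, file 2 (of 8) — the three-term λ-count at a non-split multiplicative Eisenstein datum, in
# strict-dual and in unramified-dual currency, with Greenberg 2016 Prop. 4.1.1 REPLACED by Milne ADT I Thm. 4.10 (a)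
# (helper, `--supports stmt-BirchSwinnertonDyer-19034`; width seat `bsd-line-x2-p2` gen 18)

Twins of `GrSelmerQuotientCorankLe.lambdaInvariant_xAc_eq_add_add_sum_of_not_split_of_facts` (PART A) and
`StrictEqUnramifiedCentral.lambdaInvariant_xAc_eq_add_add_sum_unr_of_not_split_of_facts` (PART B) with the binder
`(h411 : Greenberg2016.prop411_selmer_isAlmostDivisible)` REPLACED at the same position by
`hX : ∀ L [IsTotallyComplex L] S, S.Finite → poitouTate_shaRestricted_tateDual_natural_at L S`; proofs token-identical over file 1's twin.
HONEST FRAMING: bookkeeping; Prop. 4.1.1 is NOT proved; no summit statement / crux / stub proved; BSD proved for no curve. THEOREMS ONLY.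
[Greenberg2016Selmer] Prop. 4.1.1 (c); [MilneADT2006] I Thm. 4.10 (a); [KellerYin2024] Thm. 1.4.1; [GreenbergVatsal2000] §2.
-/


set_option linter.dupNamespace false
set_option autoImplicit false

noncomputable section

open scoped Classical AddSubgroup

open WeierstrassCurve NumberField IsDedekindDomain Field
  Literature.NumberTheory.EllipticCurves Literature.NumberTheory.EllipticCurves.Castella2018
  Literature.NumberTheory.EllipticCurves.GreenbergSelmer
  Literature.NumberTheory.EllipticCurves.GreenbergVatsal2000 Literature.NumberTheory.GaloisRepresentations
  Literature.NumberTheory.EllipticCurves.KellerYin2024 Literature.NumberTheory.EllipticCurves.IwasawaAlgebra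
  Literature.NumberTheory.EllipticCurves.Castella2018.AcSelmer Literature.NumberTheory.EllipticCurves.Rank1Residual
  Literature.NumberTheory.EllipticCurves.CastellaGrossiLeeSkinner2022
  Literature.NumberTheory.IwasawaTheory Literature.NumberTheory.IwasawaTheory.Greenberg2016
  Literature.NumberTheory.IwasawaTheory.Greenberg2006
open Summit.BirchSwinnertonDyer.Rank1Residual.X2.NonPrimitiveQuotientCorank
  Summit.BirchSwinnertonDyer.BirchSwinnertonDyer.Theorems
  Summit.BirchSwinnertonDyer.BirchSwinnertonDyer.Theorems.IwasawaTwoVariable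
  Summit.BirchSwinnertonDyer.BirchSwinnertonDyer.Theorems.DatumSelmerQuotientTorsionFiniteGeneric
  Summit.BirchSwinnertonDyer.BirchSwinnertonDyer.Theorems.UnrSelmerQuotientTorsionFiniteChar
  Summit.BirchSwinnertonDyer.BirchSwinnertonDyer.Theorems.UnrSelmerQuotientCorankChar
  Summit.BirchSwinnertonDyer.BirchSwinnertonDyer.Theorems.CharLocalInertiaFrobenius

namespace Summit.BirchSwinnertonDyer.BirchSwinnertonDyer.Theorems.GrSelmerQuotientCorankLe


/-! ## The three-term λ-count with Prop. 4.1.1 replaced by Milne I 4.10 (a) -/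

section Character

variable {K : Type} [Field K] [NumberField K] {p : ℕ} [Fact p.Prime]

/-- **[prop411-DROP twin: `(h411 : prop411_selmer_isAlmostDivisible)` ↦ the textbook clause `hX` (Milne ADT I Thm. 4.10 (a)); the original docstring follows with that substitution.]** **`λ(𝔛^{Sf}_f) = λ(X_Gr(θsub)) + λ(X_Gr(θquot)) + Σ_{w ∈ Sf}(λ(𝒫_w(θsub)) + λ(𝒫_w(θquot)))` at a NON-SPLIT multiplicative
Eisenstein datum, with Greenberg 2016 Prop. 4.1.1 BY NAME replaced by Milne ADT I Thm. 4.10 (a) (`hX`)** — twin of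
`lambdaInvariant_xAc_eq_add_add_sum_of_not_split_of_facts` (same binders otherwise, same proof, the (N1) input from
`XAcImprimitiveNoPTorsion.lambdaInvariant_xAc_eq_add_of_not_split_ofPoitouTateAt`).
[cite: KellerYin2024, Thm. 1.4.1 (arXiv:2402.12781v2)] [cite: CastellaGrossiLeeSkinner2022, Prop. 1.2.5, Cor. 1.2.6, Prop. 14]
[cite: Greenberg2016Selmer, Prop. 4.1.1 (c)] [cite: MilneADT2006, I Thm. 4.10 (a)] -/
theorem lambdaInvariant_xAc_eq_add_add_sum_of_not_split_ofPoitouTateAt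
    (hprop125 : prop125_characterGrSelmerDual_torsion_muZero_dim) (hge : prop125_characterGrSelmerDual_corank_ge)
    (hfact : prop14_residualCharacterSelmer_finite)
    (hlift : cor126_residualCharacter_globalLift) (hlocal : cor126_residualCharacter_localSurjective)
    (hX : ∀ (L : Type) [Field L] [NumberField L] [IsTotallyComplex L] (S : Set (HeightOneSpectrum (𝓞 L))),
      S.Finite → Literature.NumberTheory.GaloisCohomology.poitouTate_shaRestricted_tateDual_natural_at L S) (h41 : prop41_globalEulerPoincareCorank)
    (h42 : prop42_localEulerPoincareCorank) (h32 : prop32_cohomology_isCofinitelyGenerated)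
    (W : WeierstrassCurve ℚ) [W.IsElliptic] [W.IsGloballyMinimal]
    (K : Type) [Field K] [NumberField K] {v : HeightOneSpectrum (𝓞 K)} (vbar : HeightOneSpectrum (𝓞 K))
    (κ : ZpExtension K p) (γ : absoluteGaloisGroup K) [Fact (κ.IsTopGenerator γ)]
    (Sf : Finset (HeightOneSpectrum (𝓞 K)))
    (hp2 : 2 < p) (hmult : Mult W p) (hns : ¬ W.HasSplitMultiplicativeReductionAtPrime p) (hred : Red W p)
    (hK : IsImaginaryQuadratic K) (hH : SatisfiesHeegnerHypothesis (W.conductorNorm ℤ) K)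
    (hsplit : ((Ideal.span {(p : ℤ)}).primesOver (𝓞 K)).ncard = 2)
    (hv : ((p : ℕ) : 𝓞 K) ∈ v.asIdeal) (hvbar : ((p : ℕ) : 𝓞 K) ∈ vbar.asIdeal) (hne : vbar ≠ v) (hκ : κ.IsAnticyclotomic)
    (hSf : ∀ w : HeightOneSpectrum (𝓞 K), w ∈ Sf ↔
      (((W.conductorNorm ℤ : ℤ) : 𝓞 K) ∈ w.asIdeal ∧ ((p : ℕ) : 𝓞 K) ∉ w.asIdeal))
    (θsub θquot : FramedGaloisRep K (padicCoeffIntegers (∅ : Set (PadicAlgCl p))) 1)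
    (hpair : IsResidualPairOver (W.baseChange K) p θsub θquot)
    (D0sub : GrDualData κ (charModule (∅ : Set (PadicAlgCl p)) θsub) vbar (∅ : Set (HeightOneSpectrum (𝓞 K))) γ)
    (D0quot : GrDualData κ (charModule (∅ : Set (PadicAlgCl p)) θquot) vbar (∅ : Set (HeightOneSpectrum (𝓞 K))) γ) :
    lambdaInvariant p (XAc (W.baseChange K) p κ vbar (↑Sf : Set (HeightOneSpectrum (𝓞 K))) γ) =
      lambdaInvariant p D0sub.X + lambdaInvariant p D0quot.X +
        ∑ w ∈ Sf, (charLocalLambda (∅ : Set (PadicAlgCl p)) κ θsub w + charLocalLambda (∅ : Set (PadicAlgCl p)) κ θquot w) := by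
  obtain ⟨Dsub⟩ := nonempty_grDualData_char (∅ : Set (PadicAlgCl p)) θsub κ vbar (↑Sf : Set (HeightOneSpectrum (𝓞 K)))
    (Fact.out : κ.IsTopGenerator γ)
  obtain ⟨Dquot⟩ := nonempty_grDualData_char (∅ : Set (PadicAlgCl p)) θquot κ vbar (↑Sf : Set (HeightOneSpectrum (𝓞 K)))
    (Fact.out : κ.IsTopGenerator γ)
  have halg := XAcImprimitiveNoPTorsion.lambdaInvariant_xAc_eq_add_of_not_split_ofPoitouTateAt hprop125 hfact hlift hlocal hX h41 h42
    h32 W K vbar κ γ Sf hp2 hmult hns hred hK hH hsplit hv hvbar hne hκ hSf θsub θquot hpair Dsub Dquot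
  have hsub := charLambdaRelaxation_eq_of_not_split_of_facts hprop125 hge W K vbar κ γ Sf hp2 hmult hns hK hH hsplit hvbar hκ hSf
    θsub θquot hpair θsub (Or.inl rfl) Dsub D0sub
  have hquot := charLambdaRelaxation_eq_of_not_split_of_facts hprop125 hge W K vbar κ γ Sf hp2 hmult hns hK hH hsplit hvbar hκ hSf
    θsub θquot hpair θquot (Or.inr rfl) Dquot D0quot
  rw [halg, hsub, hquot, Finset.sum_add_distrib]
  ring

end Character

end Summit.BirchSwinnertonDyer.BirchSwinnertonDyer.Theorems.GrSelmerQuotientCorankLe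

end

/-! # PART B -/


set_option autoImplicit false
set_option linter.dupNamespace false -- the summit namespace `…BirchSwinnertonDyer.BirchSwinnertonDyer.Theorems` (Sub = Summit, D-0017) trips it

noncomputable section

open scoped Classical

namespace Summit.BirchSwinnertonDyer.BirchSwinnertonDyer.Theorems.StrictEqUnramifiedCentral

open NumberField IsDedekindDomain Field WeierstrassCurve
open Literature.NumberTheory.EllipticCurves Literature.NumberTheory.EllipticCurves.GreenbergSelmer
  Literature.NumberTheory.EllipticCurves.GreenbergVatsal2000 Literature.NumberTheory.GaloisRepresentations
  Literature.NumberTheory.EllipticCurves.KellerYin2024 Literature.NumberTheory.EllipticCurves.IwasawaAlgebra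
  Literature.NumberTheory.EllipticCurves.Castella2018.AcSelmer Literature.NumberTheory.EllipticCurves.Rank1Residual
  Literature.NumberTheory.EllipticCurves.CastellaGrossiLeeSkinner2022
  Literature.NumberTheory.IwasawaTheory Literature.NumberTheory.IwasawaTheory.Greenberg2016
  Literature.NumberTheory.IwasawaTheory.Greenberg2006


section Datum

variable {K : Type} [Field K] [NumberField K] {p : ℕ} [hp : Fact p.Prime]

/-- **[prop411-DROP twin: `(h411 : prop411_selmer_isAlmostDivisible)` ↦ the textbook clause `hX` (Milne ADT I Thm. 4.10 (a)); the original docstring follows with that substitution.]** **`λ(𝔛^{Sf}_f) = λ(X_nr(θsub)) + λ(X_nr(θquot)) + Σ_{w ∈ Sf}(…)` — the three-term count with the two character duals read as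
UNRAMIFIED duals, at a NON-SPLIT multiplicative Eisenstein datum, with Greenberg 2016 Prop. 4.1.1 BY NAME replaced by Milne ADT I
Thm. 4.10 (a) (`hX`)** — twin of `lambdaInvariant_xAc_eq_add_add_sum_unr_of_not_split_of_facts` (same binders otherwise, same proof
over file 3's twin). [cite: KellerYin2024, Thm. 1.4.1 (arXiv:2402.12781v2)] [cite: GreenbergVatsal2000, §2 pp. 15–21]
[cite: Greenberg2016Selmer, Prop. 4.1.1 (c)] [cite: MilneADT2006, I Thm. 4.10 (a)] -/
theorem lambdaInvariant_xAc_eq_add_add_sum_unr_of_not_split_ofPoitouTateAt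
    (hprop125 : prop125_characterGrSelmerDual_torsion_muZero_dim) (hge : prop125_characterGrSelmerDual_corank_ge)
    (hfact : prop14_residualCharacterSelmer_finite)
    (hlift : cor126_residualCharacter_globalLift) (hlocal : cor126_residualCharacter_localSurjective)
    (hX : ∀ (L : Type) [Field L] [NumberField L] [IsTotallyComplex L] (S : Set (HeightOneSpectrum (𝓞 L))),
      S.Finite → Literature.NumberTheory.GaloisCohomology.poitouTate_shaRestricted_tateDual_natural_at L S) (h41 : prop41_globalEulerPoincareCorank)
    (h42 : prop42_localEulerPoincareCorank) (h32 : prop32_cohomology_isCofinitelyGenerated)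
    (W : WeierstrassCurve ℚ) [W.IsElliptic] [W.IsGloballyMinimal]
    (K : Type) [Field K] [NumberField K] {v : HeightOneSpectrum (𝓞 K)} (vbar : HeightOneSpectrum (𝓞 K))
    (κ : ZpExtension K p) (γ : absoluteGaloisGroup K) [Fact (κ.IsTopGenerator γ)]
    (Sf : Finset (HeightOneSpectrum (𝓞 K)))
    (hp2 : 2 < p) (hmult : Mult W p) (hns : ¬ W.HasSplitMultiplicativeReductionAtPrime p) (hred : Red W p)
    (hK : IsImaginaryQuadratic K) (hH : SatisfiesHeegnerHypothesis (W.conductorNorm ℤ) K)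
    (hsplit : ((Ideal.span {(p : ℤ)}).primesOver (𝓞 K)).ncard = 2)
    (hv : ((p : ℕ) : 𝓞 K) ∈ v.asIdeal) (hvbar : ((p : ℕ) : 𝓞 K) ∈ vbar.asIdeal) (hne : vbar ≠ v) (hκ : κ.IsAnticyclotomic)
    (hSf : ∀ w : HeightOneSpectrum (𝓞 K), w ∈ Sf ↔
      (((W.conductorNorm ℤ : ℤ) : 𝓞 K) ∈ w.asIdeal ∧ ((p : ℕ) : 𝓞 K) ∉ w.asIdeal))
    (θsub θquot : FramedGaloisRep K (padicCoeffIntegers (∅ : Set (PadicAlgCl p))) 1)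
    (hpair : IsResidualPairOver (W.baseChange K) p θsub θquot)
    (D0sub : DatumDualData κ γ (charModule (∅ : Set (PadicAlgCl p)) θsub)
      (Castella2018.AcSelmer.bdpData (charModule (∅ : Set (PadicAlgCl p)) θsub) p vbar) (∅ : Set (HeightOneSpectrum (𝓞 K))))
    (D0quot : DatumDualData κ γ (charModule (∅ : Set (PadicAlgCl p)) θquot)
      (Castella2018.AcSelmer.bdpData (charModule (∅ : Set (PadicAlgCl p)) θquot) p vbar) (∅ : Set (HeightOneSpectrum (𝓞 K)))) :
    lambdaInvariant p (XAc (W.baseChange K) p κ vbar (↑Sf : Set (HeightOneSpectrum (𝓞 K))) γ) =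
      lambdaInvariant p D0sub.X + lambdaInvariant p D0quot.X +
        ∑ w ∈ Sf, (charLocalLambda (∅ : Set (PadicAlgCl p)) κ θsub w + charLocalLambda (∅ : Set (PadicAlgCl p)) κ θquot w) := by
  have hsub := grSelmer_eq_unrSelmer_of_not_split κ vbar (∅ : Set (HeightOneSpectrum (𝓞 K))) θsub W Sf hp2 hmult hns hK hH
    hsplit hvbar hSf θsub θquot hpair (Or.inl rfl)
  have hquot := grSelmer_eq_unrSelmer_of_not_split κ vbar (∅ : Set (HeightOneSpectrum (𝓞 K))) θquot W Sf hp2 hmult hns hK hH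
    hsplit hvbar hSf θsub θquot hpair (Or.inr rfl)
  have hG : ∀ (Gs : GrDualData κ (charModule (∅ : Set (PadicAlgCl p)) θsub) vbar (∅ : Set (HeightOneSpectrum (𝓞 K))) γ)
      (Gq : GrDualData κ (charModule (∅ : Set (PadicAlgCl p)) θquot) vbar (∅ : Set (HeightOneSpectrum (𝓞 K))) γ),
      lambdaInvariant p (XAc (W.baseChange K) p κ vbar (↑Sf : Set (HeightOneSpectrum (𝓞 K))) γ) =
        lambdaInvariant p Gs.X + lambdaInvariant p Gq.X +
          ∑ w ∈ Sf, (charLocalLambda (∅ : Set (PadicAlgCl p)) κ θsub w + charLocalLambda (∅ : Set (PadicAlgCl p)) κ θquot w) :=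
    fun Gs Gq ↦ GrSelmerQuotientCorankLe.lambdaInvariant_xAc_eq_add_add_sum_of_not_split_ofPoitouTateAt hprop125 hge hfact hlift
      hlocal hX h41 h42 h32 W K vbar κ γ Sf hp2 hmult hns hred hK hH hsplit hv hvbar hne hκ hSf θsub θquot hpair Gs Gq
  have h1 : ∀ Gq : GrDualData κ (charModule (∅ : Set (PadicAlgCl p)) θquot) vbar (∅ : Set (HeightOneSpectrum (𝓞 K))) γ,
      lambdaInvariant p (XAc (W.baseChange K) p κ vbar (↑Sf : Set (HeightOneSpectrum (𝓞 K))) γ) =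
        lambdaInvariant p D0sub.X + lambdaInvariant p Gq.X +
          ∑ w ∈ Sf, (charLocalLambda (∅ : Set (PadicAlgCl p)) κ θsub w + charLocalLambda (∅ : Set (PadicAlgCl p)) κ θquot w) :=
    fun Gq ↦ prop_datumDualData_of_forall_grDualData κ vbar ∅ hsub
      (fun (X : Type) [AddCommGroup X] [Module (IwasawaAlgebra p) X] ↦
        lambdaInvariant p (XAc (W.baseChange K) p κ vbar (↑Sf : Set (HeightOneSpectrum (𝓞 K))) γ) =
        lambdaInvariant p X + lambdaInvariant p Gq.X +
          ∑ w ∈ Sf, (charLocalLambda (∅ : Set (PadicAlgCl p)) κ θsub w + charLocalLambda (∅ : Set (PadicAlgCl p)) κ θquot w))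
      (fun Gs ↦ hG Gs Gq) D0sub
  exact prop_datumDualData_of_forall_grDualData κ vbar ∅ hquot
    (fun (Y : Type) [AddCommGroup Y] [Module (IwasawaAlgebra p) Y] ↦
      lambdaInvariant p (XAc (W.baseChange K) p κ vbar (↑Sf : Set (HeightOneSpectrum (𝓞 K))) γ) =
      lambdaInvariant p D0sub.X + lambdaInvariant p Y +
        ∑ w ∈ Sf, (charLocalLambda (∅ : Set (PadicAlgCl p)) κ θsub w + charLocalLambda (∅ : Set (PadicAlgCl p)) κ θquot w))
    h1 D0quot

end Datum

end Summit.BirchSwinnertonDyer.BirchSwinnertonDyer.Theorems.StrictEqUnramifiedCentral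

end
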